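import Summits.CriticalPhenomena.PercolationContinuityZ3.Theorems.PercNearOneGluingAdditiveGluingBystanderReach
import Summits.CriticalPhenomena.PercolationContinuityZ3.Theorems.PercNearOneGluingAdditiveGluingRelayLayersNoDrift
import HarnessLib

/-! # Crux `PercNearOneGluing.AdditiveGluing` (stmt-CriticalPhenomena-4576) — the crux follows from the DESIGNATED-POCKET
# kernel `D` (pre-FKG (3) at the un-glued minimiser in the glued graph), a kernel that is WEAKER than block goodness and
# multi-affine in every pair weight (exchange-certificate form, seat (d) round 4)

Support file (`--supports stmt-CriticalPhenomena-4576`); no definitions, no named facts.  CONDITIONAL result (hypothesis spelled out).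

`μ_u = prodBernoulli u`; relays `A ∋ b`; a block `S` disjoint from `A`; `u/S` = `u` with the non-loop pairs inside `S` given weight
`1` (the glued block); `a₀ ∈ A` a minimiser of `μ_u(· ↔ b)` over `A` (the UN-glued two-point function).  The **designated-pocket
kernel** is the inequality
  `D(u,S,a₀) :  μ_{u/S}((S ↔ A) ∩ (a₀ ↔ b)) ≤ μ_{u/S}(S ↔ b)`,    `S ↔ X := ⋃_{v∈S} ⋃_{x∈X} {v ↔ x}`,
i.e. Kozma–Nitzan's pre-FKG inequality (3) for the quadruple `(u/S, A, s, b)` AT THE DESIGNATION `a₀` (Question 9 shape).  In the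
un-glued weighting it reads `τ_{u/S}(a₀) ≤ reach_u(S) + μ_u(a₀ ↔ b, K_S ∩ A = ∅)`: the block-goodness kernel of the cone line
(`stub_cone7Assembly_c5`) with the pocket term taken AT `a₀` instead of the worst relay, so block goodness implies it (the pocket
deficit `Σ_W μ(K_S = W)[μ(a₀ ↔ b off W) − min_a μ(a ↔ b off W)] ≥ 0` is exactly the difference), and every one of its terms is a plain
probability — `D` is multi-affine in every pair weight (no minimum).

* `dcone_q9`: the kernel for every block of non-relays gives KN's Question 9 inequality
  `μ_w((o ↔ A) ∩ (a₀ ↔ b)) ≤ μ_w(o ↔ b)` for the minimiser `a₀` of the star-killed two-point function: partition by the open star `B`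
  of `o` (`sigmaRec_partition`), move each layer to the star-killed weighting with `B` glued (`stub_sigmaGeometry`, `stub_sigmaLaw`);
  relay layers are Kozma–Nitzan's Lemma 5 in block form (`relayNoDrift_designated_le_reach`), relay-free layers are the kernel.
* `additiveGluing_of_dcone`: hence `AdditiveGluing` (crux statement unfolded): `μ(o↔b) ≥ μ(o↔A, a₀↔b) ≥ μ(o↔A) − μ(a₀↮b) ≥ μ(o↔A) − t`
  (level-set normal form `A' = {x | 1 − t ≤ μ(x↔b)} ∋ b` as in `cone7_additiveGluing_of`).
So the load-bearing inequality of the route is `D ≥ 0`, not block goodness: the pocket deficit is not load-bearing.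
[cite: KozmaNitzan2024, §1 eq. (3) p. 3, §3.2 Thms 4–5 pp. 12–14, Lemma 5 p. 13, Question 9 p. 36]
-/

namespace Summit.CriticalPhenomena.PercolationContinuityZ3.Theorems

open MeasureTheory Set
open Literature.Probability.LatticeModels (prodBernoulli)
open Literature.Probability.Percolation (BondConfig openConn openConnIn openGraph openCluster)
open scoped BigOperators

noncomputable section
open Classical

section DConeAssembly

open Literature.Probability.LatticeModels Literature.Probability.Percolation

variable {n : ℕ}

/-- **Question 9 from the designated-pocket kernel.**  For an observer `o ∉ A ∋ b` and a minimiser `a₀ ∈ A` of the two-point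
function of the star-killed weighting `u = w − o`, `μ_w((o ↔ A) ∩ (a₀ ↔ b)) ≤ μ_w(o ↔ b)` — provided the kernel `D` holds for every
block of non-relays in `u`.  [cite: KozmaNitzan2024, §3.2 pp. 13–14 (σ_B-decomposition), Lemma 5 p. 13, Question 9 p. 36] -/
theorem dcone_q9
    (hD : ∀ (n : ℕ) (u : Sym2 (Fin n) → unitInterval) (A S : Finset (Fin n)) (b a₀ : Fin n),
      b ∈ A → Disjoint S A → a₀ ∈ A →
      (∀ a ∈ A, (prodBernoulli u).real (openConn a₀ b) ≤ (prodBernoulli u).real (openConn a b)) →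
      (prodBernoulli (fun e : Sym2 (Fin n) => if (∀ y ∈ e, y ∈ S) ∧ ¬ e.IsDiag then 1 else u e)).real
          ((⋃ v ∈ S, ⋃ a ∈ A, openConn v a) ∩ openConn a₀ b)
        ≤ (prodBernoulli (fun e : Sym2 (Fin n) => if (∀ y ∈ e, y ∈ S) ∧ ¬ e.IsDiag then 1 else u e)).real
          (⋃ v ∈ S, openConn v b))
    (w : Sym2 (Fin n) → unitInterval) (A : Finset (Fin n)) (o b a₀ : Fin n) (hb : b ∈ A) (ho : o ∉ A) (ha₀ : a₀ ∈ A)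
    (hmin : ∀ a ∈ A, (prodBernoulli (fun e : Sym2 (Fin n) => if (∃ y ∈ e, y ∈ ({o} : Finset (Fin n))) then (0 : unitInterval) else w e)).real (openConn a₀ b)
      ≤ (prodBernoulli (fun e : Sym2 (Fin n) => if (∃ y ∈ e, y ∈ ({o} : Finset (Fin n))) then (0 : unitInterval) else w e)).real (openConn a b)) :
    (prodBernoulli w).real ((⋃ a ∈ A, openConn o a) ∩ openConn a₀ b) ≤ (prodBernoulli w).real (openConn o b) := by
  have hbo : b ≠ o := fun h => ho (h ▸ hb)
  have ha₀o : a₀ ≠ o := fun h => ho (h ▸ ha₀)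
  set u : Sym2 (Fin n) → unitInterval :=
    fun e : Sym2 (Fin n) => if (∃ y ∈ e, y ∈ ({o} : Finset (Fin n))) then (0 : unitInterval) else w e with hu
  rw [sigmaRec_partition w ({o} : Finset (Fin n)) ((⋃ a ∈ A, openConn o a) ∩ openConn a₀ b),
    sigmaRec_partition w ({o} : Finset (Fin n)) (openConn o b)]
  refine Finset.sum_le_sum fun B _ => ?_
  have hclique : ∀ ω : BondConfig (Fin n), ∀ o₁ ∈ ({o} : Finset (Fin n)), ∀ o₂ ∈ ({o} : Finset (Fin n)), o₁ ≠ o₂ → s(o₁, o₂) ∈ ω := by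
    intro ω o₁ h₁ o₂ h₂ hne
    exact absurd ((Finset.mem_singleton.1 h₁).trans (Finset.mem_singleton.1 h₂).symm) hne
  -- rewrite both layer pieces through `Ψ_B`
  have hgeomL : {ω : BondConfig (Fin n) | ∀ y : Fin n, y ∈ B ↔ (y ∉ ({o} : Finset (Fin n)) ∧ ∃ o' ∈ ({o} : Finset (Fin n)), s(o', y) ∈ ω)}
        ∩ ((⋃ a ∈ A, openConn o a) ∩ openConn a₀ b)
      = {ω : BondConfig (Fin n) | ∀ y : Fin n, y ∈ B ↔ (y ∉ ({o} : Finset (Fin n)) ∧ ∃ o' ∈ ({o} : Finset (Fin n)), s(o', y) ∈ ω)}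
        ∩ {ω | ({e | e ∈ ω ∧ ∀ x ∈ e, x ∉ ({o} : Finset (Fin n))} ∪ {e | (∀ x ∈ e, x ∈ B) ∧ ¬ e.IsDiag}) ∈
            ((⋃ v ∈ B, ⋃ a ∈ A, openConn v a) ∩ openConn a₀ b : Set (BondConfig (Fin n)))} := by
    ext ω
    simp only [Set.mem_inter_iff, Set.mem_setOf_eq]
    refine and_congr_right fun hL => ?_
    obtain ⟨h1, h2⟩ := stub_sigmaGeometry n ({o} : Finset (Fin n)) B ω hL (hclique ω)
    have hA := h1 A (Finset.disjoint_singleton_left.2 ho)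
    simp only [Finset.set_biUnion_singleton] at hA
    have hab := h2 a₀ b (by simp [ha₀o]) (by simp [hbo])
    exact and_congr hA hab
  have hgeomR : {ω : BondConfig (Fin n) | ∀ y : Fin n, y ∈ B ↔ (y ∉ ({o} : Finset (Fin n)) ∧ ∃ o' ∈ ({o} : Finset (Fin n)), s(o', y) ∈ ω)}
        ∩ openConn o b
      = {ω : BondConfig (Fin n) | ∀ y : Fin n, y ∈ B ↔ (y ∉ ({o} : Finset (Fin n)) ∧ ∃ o' ∈ ({o} : Finset (Fin n)), s(o', y) ∈ ω)}
        ∩ {ω | ({e | e ∈ ω ∧ ∀ x ∈ e, x ∉ ({o} : Finset (Fin n))} ∪ {e | (∀ x ∈ e, x ∈ B) ∧ ¬ e.IsDiag}) ∈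
            (⋃ v ∈ B, openConn v b : Set (BondConfig (Fin n)))} := by
    ext ω
    simp only [Set.mem_inter_iff, Set.mem_setOf_eq]
    refine and_congr_right fun hL => ?_
    obtain ⟨h1, -⟩ := stub_sigmaGeometry n ({o} : Finset (Fin n)) B ω hL (hclique ω)
    have hB := h1 {b} (by simp [hbo.symm])
    simp only [Finset.set_biUnion_singleton] at hB
    exact hB
  have hlawL := stub_sigmaLaw n w {o} B ((⋃ v ∈ B, ⋃ a ∈ A, openConn v a) ∩ openConn a₀ b)
  have hlawR := stub_sigmaLaw n w {o} B (⋃ v ∈ B, openConn v b)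
  rw [peelGlue_glue_singleton w o] at hlawL hlawR
  rw [hgeomL, hlawL, hgeomR, hlawR]
  refine mul_le_mul_of_nonneg_left ?_ measureReal_nonneg
  -- the layer inequality in the star-killed weighting with `B` glued
  by_cases hBA : Disjoint B A
  · exact hD n u A B b a₀ hb hBA ha₀ hmin
  · obtain ⟨v, hvB, hvA⟩ := Finset.not_disjoint_iff.1 hBA
    have h5 := relayNoDrift_designated_le_reach u B B a₀ v b (subset_refl B) hvB (hmin v hvA)
    rw [hu] at h5
    have hmono : (prodBernoulli (fun e : Sym2 (Fin n) => if (∀ y ∈ e, y ∈ B) ∧ ¬ e.IsDiag then 1 else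
        (fun e : Sym2 (Fin n) => if (∃ y ∈ e, y ∈ ({o} : Finset (Fin n))) then (0 : unitInterval) else w e) e)).real
          ((⋃ v ∈ B, ⋃ a ∈ A, openConn v a) ∩ openConn a₀ b)
        ≤ (prodBernoulli (fun e : Sym2 (Fin n) => if (∀ y ∈ e, y ∈ B) ∧ ¬ e.IsDiag then 1 else
        (fun e : Sym2 (Fin n) => if (∃ y ∈ e, y ∈ ({o} : Finset (Fin n))) then (0 : unitInterval) else w e) e)).real
          (openConn a₀ b) :=
      measureReal_mono Set.inter_subset_right (measure_ne_top _ _)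
    have hgain : 0 ≤ (prodBernoulli (fun e : Sym2 (Fin n) => if (∀ y ∈ e, y ∈ B) ∧ ¬ e.IsDiag then 1 else
        (fun e : Sym2 (Fin n) => if (∃ y ∈ e, y ∈ ({o} : Finset (Fin n))) then (0 : unitInterval) else w e) e)).real
          ((openConn a₀ b)ᶜ ∩ (⋃ v ∈ B, openConn a₀ v) ∩ (⋃ v ∈ B, openConn v b)) := measureReal_nonneg
    linarith

/-- **`AdditiveGluing` from the designated-pocket kernel** (crux statement unfolded).  [cite: KozmaNitzan2024, §1 (3) p. 3, §3.2 pp. 12–14, Question 9 p. 36] -/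
theorem additiveGluing_of_dcone
    (hD : ∀ (n : ℕ) (u : Sym2 (Fin n) → unitInterval) (A S : Finset (Fin n)) (b a₀ : Fin n),
      b ∈ A → Disjoint S A → a₀ ∈ A →
      (∀ a ∈ A, (prodBernoulli u).real (openConn a₀ b) ≤ (prodBernoulli u).real (openConn a b)) →
      (prodBernoulli (fun e : Sym2 (Fin n) => if (∀ y ∈ e, y ∈ S) ∧ ¬ e.IsDiag then 1 else u e)).real
          ((⋃ v ∈ S, ⋃ a ∈ A, openConn v a) ∩ openConn a₀ b)
        ≤ (prodBernoulli (fun e : Sym2 (Fin n) => if (∀ y ∈ e, y ∈ S) ∧ ¬ e.IsDiag then 1 else u e)).real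
          (⋃ v ∈ S, openConn v b)) :
    ∀ (n : ℕ) (w : Sym2 (Fin n) → unitInterval) (A : Finset (Fin n)) (o b : Fin n) (t : ℝ), 0 ≤ t →
      (∀ a ∈ A, 1 - t ≤ (prodBernoulli w).real (openConn a b)) →
      (prodBernoulli w).real (⋃ a ∈ A, openConn o a) - t ≤ (prodBernoulli w).real (openConn o b) := by
  intro n w A o b t ht hA
  have hU1 : (prodBernoulli w).real (⋃ a ∈ A, (openConn o a : Set (BondConfig (Fin n)))) ≤ 1 := measureReal_le_one
  have hob0 : 0 ≤ (prodBernoulli w).real (openConn o b : Set (BondConfig (Fin n))) := measureReal_nonneg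
  by_cases ht1 : 1 ≤ t
  · linarith
  push Not at ht1
  -- level-set normal form: `A' = {x | 1 - t ≤ μ(x ↔ b)} ⊇ A`, `b ∈ A'`
  set A' : Finset (Fin n) := Finset.univ.filter (fun x : Fin n => 1 - t ≤ (prodBernoulli w).real (openConn x b)) with hA'
  have hbb : (prodBernoulli w).real (openConn b b : Set (BondConfig (Fin n))) = 1 := by
    have h : (openConn b b : Set (BondConfig (Fin n))) = Set.univ :=
      Set.eq_univ_of_forall fun ω => (SimpleGraph.Reachable.refl b : (openGraph ω).Reachable b b)
    rw [h, probReal_univ]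
  have hbA' : b ∈ A' := by
    rw [hA', Finset.mem_filter]
    refine ⟨Finset.mem_univ _, ?_⟩
    rw [hbb]
    linarith
  have hmemA' : ∀ x ∈ A', 1 - t ≤ (prodBernoulli w).real (openConn x b) := fun x hx => by
    rw [hA', Finset.mem_filter] at hx
    exact hx.2
  by_cases ho : o ∈ A'
  · have := hmemA' o ho
    linarith
  -- the designation: a minimiser of the star-killed two-point function over `A'`
  obtain ⟨a₀, ha₀, hmin⟩ := Finset.exists_min_image A'
    (fun a => (prodBernoulli (fun e : Sym2 (Fin n) => if (∃ y ∈ e, y ∈ ({o} : Finset (Fin n))) then (0 : unitInterval) else w e)).real (openConn a b))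
    ⟨b, hbA'⟩
  have hq9 := dcone_q9 hD w A' o b a₀ hbA' ho ha₀ hmin
  -- `μ(o ↔ A', a₀ ↔ b) ≥ μ(o ↔ A') - μ(a₀ ↮ b) ≥ μ(o ↔ A) - t`
  have hcompl : (prodBernoulli w).real (openConn a₀ b : Set (BondConfig (Fin n)))ᶜ ≤ t := by
    have h1 : (prodBernoulli w).real (openConn a₀ b : Set (BondConfig (Fin n)))
        + (prodBernoulli w).real (openConn a₀ b : Set (BondConfig (Fin n)))ᶜ = 1 :=
      probReal_add_probReal_compl MeasurableSet.of_discrete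
    have h2 := hmemA' a₀ ha₀
    linarith
  have hsub : (⋃ a ∈ A, (openConn o a : Set (BondConfig (Fin n)))) ⊆
      ((⋃ a ∈ A', (openConn o a : Set (BondConfig (Fin n)))) ∩ openConn a₀ b) ∪ (openConn a₀ b)ᶜ := by
    intro ω hω
    by_cases hab : ω ∈ (openConn a₀ b : Set (BondConfig (Fin n)))
    · refine Or.inl ⟨?_, hab⟩
      simp only [Set.mem_iUnion] at hω ⊢
      obtain ⟨a, ha, hωa⟩ := hω
      refine ⟨a, ?_, hωa⟩
      rw [hA', Finset.mem_filter]
      exact ⟨Finset.mem_univ _, hA a ha⟩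
    · exact Or.inr hab
  have hfin := (measureReal_mono (μ := prodBernoulli w) hsub (measure_ne_top _ _)).trans (measureReal_union_le _ _)
  linarith

end DConeAssembly

end

end Summit.CriticalPhenomena.PercolationContinuityZ3.Theorems
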